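import Summits.QuantumFields.YangMills.Theorems.LogConcaveChartTransportFrame
import Literature.Probability.Distributions.GaussianPiDensity
import Mathlib.MeasureTheory.Measure.Lebesgue.EqHaar

/-!
# Route `LogConcaveChart` — toolkit for the support item `TransportCovarianceTransfer`
(stmt-QuantumFields-23668, child of the transport split of crux `QuadraticCovarianceComparison`,
stmt-QuantumFields-26240): **density form of the Gaussian side and the linear change of variables**

The item speaks of normalised Lebesgue integrals against `e^{−xᵀH₀x/2}` and `e^{−A}`; the analytic
estimates were proved against the product measure `γ = ⊗ⁿ 𝒩(0,1)`.  This file bridges the two: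

* `integral_pi_gaussianReal_one_eq_div` — `∫ F dγ = (∫ F e^{−|x|²/2} dx) / (∫ e^{−|x|²/2} dx)` for
  every `F` (from the tree's `pi_gaussianReal_eq_smul_withDensity`; the normalising constant is
  eliminated with `F = 1`, so no Gaussian integral is evaluated);
* `integral_comp_mulVec` — the linear change of variables `∫ h(P x) dx = |det P|⁻¹ ∫ h(y) dy`
  (`Measure.map_linearMap_addHaar_pi_eq_smul_addHaar`, no measurability of `h` needed);
* `integral_conj_eq_div` — for `P` symmetric invertible with `P² = H₀` and any map `T`, any `G`:
  `∫ G(P T(P⁻¹ y)) dγ(y) = (∫ G(P T x) e^{−xᵀH₀x/2} dx) / (∫ e^{−xᵀH₀x/2} dx)`.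

HONEST SCOPE. Helper lemmas toward ONE support item of a sub-line; nothing here proves
`TransportCovarianceTransfer`, `QuadraticCovarianceComparison`, the `LogConcaveChart` thesis, rung R2a
(`BalabanLadder.NT`) or any summit statement; the Yang–Mills mass gap is NOT proved.  Filed by
ideator seat ym-idea-8 (generation 8, lens «dual» = transport side).
-/

namespace Summit.QuantumFields.YangMills.Cruxes.TransportCovarianceTransfer

open MeasureTheory ProbabilityTheory Matrix
open scoped NNReal ENNReal

variable {n : ℕ}

/-- **`γ` as a normalised density**: `∫ F dγ = (∫ F e^{−|x|²/2} dx) / (∫ e^{−|x|²/2} dx)` for every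
`F : ℝⁿ → ℝ` (integrable or not — both sides use the same junk conventions up to the positive
normalising factor). [folklore] -/
theorem integral_pi_gaussianReal_one_eq_div (F : (Fin n → ℝ) → ℝ) :
    ∫ x, F x ∂(Measure.pi fun _ : Fin n => gaussianReal 0 1) =
      (∫ x, F x * Real.exp (-(x ⬝ᵥ x) / 2)) / ∫ x : Fin n → ℝ, Real.exp (-(x ⬝ᵥ x) / 2) := by
  have hρm : Measurable fun ω : Fin n → ℝ =>
      ENNReal.ofReal (Real.exp (-(∑ i, ω i ^ 2 / 2) / ((1 : ℝ≥0) : ℝ))) :=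
    (Continuous.measurable (by fun_prop)).ennreal_ofReal
  have hexp : ∀ x : Fin n → ℝ,
      Real.exp (-(∑ i, x i ^ 2 / 2) / ((1 : ℝ≥0) : ℝ)) = Real.exp (-(x ⬝ᵥ x) / 2) := by
    intro x
    congr 1
    rw [NNReal.coe_one, div_one]
    simp only [dotProduct, sq, Finset.sum_div, neg_div]
  have key : ∀ G : (Fin n → ℝ) → ℝ, ∫ x, G x ∂(Measure.pi fun _ : Fin n => gaussianReal 0 1) =
      (ENNReal.ofReal ((Real.sqrt (2 * Real.pi * ((1 : ℝ≥0) : ℝ)))⁻¹ ^ n)).toReal *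
        ∫ x, G x * Real.exp (-(x ⬝ᵥ x) / 2) := by
    intro G
    rw [Literature.Probability.Distributions.pi_gaussianReal_eq_smul_withDensity n
        (one_ne_zero : (1 : ℝ≥0) ≠ 0), integral_smul_measure,
      integral_withDensity_eq_integral_toReal_smul hρm
        (Filter.Eventually.of_forall fun _ => ENNReal.ofReal_lt_top), smul_eq_mul]
    congr 1
    refine integral_congr_ae (Filter.Eventually.of_forall fun x => ?_)
    dsimp only
    rw [ENNReal.toReal_ofReal (Real.exp_nonneg _), hexp, smul_eq_mul, mul_comm]
  have h1 := key fun _ => (1 : ℝ)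
  simp only [integral_const, probReal_univ, one_smul, one_mul] at h1
  rw [key F, eq_div_iff (fun h0 => by rw [h0, mul_zero] at h1; exact one_ne_zero h1)]
  calc (ENNReal.ofReal ((Real.sqrt (2 * Real.pi * ((1 : ℝ≥0) : ℝ)))⁻¹ ^ n)).toReal *
        (∫ x, F x * Real.exp (-(x ⬝ᵥ x) / 2)) * ∫ x : Fin n → ℝ, Real.exp (-(x ⬝ᵥ x) / 2)
      = (∫ x, F x * Real.exp (-(x ⬝ᵥ x) / 2)) *
          ((ENNReal.ofReal ((Real.sqrt (2 * Real.pi * ((1 : ℝ≥0) : ℝ)))⁻¹ ^ n)).toReal *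
            ∫ x : Fin n → ℝ, Real.exp (-(x ⬝ᵥ x) / 2)) := by ring
    _ = ∫ x, F x * Real.exp (-(x ⬝ᵥ x) / 2) := by rw [← h1, mul_one]

/-- **Linear change of variables** on `ℝⁿ`: `∫ h(P x) dx = |det P|⁻¹ · ∫ h(y) dy` for `det P ≠ 0`
and every `h`. [folklore] -/
theorem integral_comp_mulVec {P : Matrix (Fin n) (Fin n) ℝ} (hP : P.det ≠ 0)
    (h : (Fin n → ℝ) → ℝ) : ∫ x, h (P *ᵥ x) = |P.det|⁻¹ * ∫ y, h y := by
  have hinj : LinearMap.ker (Matrix.toLin' P) = ⊥ := by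
    refine LinearMap.ker_eq_bot.mpr fun x y hxy => ?_
    have h' := congrArg (fun z => P⁻¹ *ᵥ z) hxy
    simpa only [Matrix.toLin'_apply, inv_mulVec_mulVec hP] using h'
  have hemb : MeasurableEmbedding (Matrix.toLin' P) :=
    (LinearMap.isClosedEmbedding_of_injective hinj).measurableEmbedding
  have hdet : LinearMap.det (Matrix.toLin' P) ≠ 0 := by rwa [LinearMap.det_toLin']
  calc ∫ x, h (P *ᵥ x) = ∫ x, h (Matrix.toLin' P x) := by simp only [Matrix.toLin'_apply]
    _ = ∫ y, h y ∂(Measure.map (Matrix.toLin' P) volume) := (hemb.integral_map h).symm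
    _ = |P.det|⁻¹ * ∫ y, h y := by
        rw [Measure.map_linearMap_addHaar_pi_eq_smul_addHaar hdet, integral_smul_measure,
          ENNReal.toReal_ofReal (abs_nonneg _), smul_eq_mul, LinearMap.det_toLin', abs_inv]

/-- **The conjugated map against `γ` in density form**: for `P` symmetric invertible with
`P² = H₀`, any map `T` and any `G`,
`∫ G(P T(P⁻¹ y)) dγ(y) = (∫ G(P T x) e^{−xᵀH₀x/2} dx) / (∫ e^{−xᵀH₀x/2} dx)`. [folklore] -/
theorem integral_conj_eq_div {H₀ P : Matrix (Fin n) (Fin n) ℝ} (hPs : P.IsSymm) (hP : P.det ≠ 0)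
    (hPP : P * P = H₀) (T : (Fin n → ℝ) → (Fin n → ℝ)) (G : (Fin n → ℝ) → ℝ) :
    ∫ y, G (P *ᵥ T (P⁻¹ *ᵥ y)) ∂(Measure.pi fun _ : Fin n => gaussianReal 0 1) =
      (∫ x, G (P *ᵥ T x) * Real.exp (-(x ⬝ᵥ H₀ *ᵥ x) / 2)) /
        ∫ x : Fin n → ℝ, Real.exp (-(x ⬝ᵥ H₀ *ᵥ x) / 2) := by
  rw [integral_pi_gaussianReal_one_eq_div]
  have hd : |P.det| ≠ 0 := abs_ne_zero.mpr hP
  have e1 : ∫ y, G (P *ᵥ T (P⁻¹ *ᵥ y)) * Real.exp (-(y ⬝ᵥ y) / 2) =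
      |P.det| * ∫ x, G (P *ᵥ T x) * Real.exp (-(x ⬝ᵥ H₀ *ᵥ x) / 2) := by
    have h := integral_comp_mulVec hP fun y => G (P *ᵥ T (P⁻¹ *ᵥ y)) * Real.exp (-(y ⬝ᵥ y) / 2)
    simp only [inv_mulVec_mulVec hP, mulVec_dotProduct_mulVec hPs, hPP] at h
    rw [h, ← mul_assoc, mul_inv_cancel₀ hd, one_mul]
  have e2 : ∫ y : Fin n → ℝ, Real.exp (-(y ⬝ᵥ y) / 2) =
      |P.det| * ∫ x, Real.exp (-(x ⬝ᵥ H₀ *ᵥ x) / 2) := by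
    have h := integral_comp_mulVec hP fun y => Real.exp (-(y ⬝ᵥ y) / 2)
    simp only [mulVec_dotProduct_mulVec hPs, hPP] at h
    rw [h, ← mul_assoc, mul_inv_cancel₀ hd, one_mul]
  rw [e1, e2, mul_div_mul_left _ _ hd]

end Summit.QuantumFields.YangMills.Cruxes.TransportCovarianceTransfer
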